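import Summits.KontsevichZagierPeriods.Zeta5Search.Certificates.RayC1KernelPeriodicBricksA
import Summits.KontsevichZagierPeriods.Zeta5Search.Certificates.RayC1KernelPeriodicBricksB
import HarnessLib

/-!
# ζ(5) search — certificates: the BRICK periodic table of the ray RayC1, assembled (772 entries), with its checks and certified rates (CERT-1 g6)

HONEST FRAMING: systematic search; no irrationality claim unless certified.  Data bookkeeping; every exponent this feeds is `< 1`
(calibration ladder of the T1-map ray C1; no crossing claimed).

OUR work (Summit side; cert-1 seat, generation 6).  `c1PerBricks = c1PerBrickA ++ c1PerBrickB` lists ALL 772 brick `ν`-cells of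
`RayC1KernelNuBrick.c1Cells` as periodic entries `(a₀/b₀, a₁/b₁, 2c, 8·j + 6)`; it passes `pBrickCond` (so `psound_brick` applies at EVERY
shift), is chained, and its closed-form rates `Σ pterm m₁` are certified for `m₁ = 16, 4, 1`:
* `c1PerBricks_rate16_ge : 2855032/10⁷ ≤ …` — with `m₁ = 16` the periodic consumer `RayC1KernelPeriodic.c1_exponent_of_tables` on
  `(tab, c1PerBricks)` is typer g17's uniform tail (`RayC1KernelStepTail*`, digamma value 0.28555) in periodic-table form;
* `c1PerBricks_rate4_ge : 11391629/10⁷ ≤ …` — `m₁ = 4`: replaces the 9 264-row `c1Deep*` tables AND the tail (digamma value 1.14215);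
* `c1PerBricks_rate1_ge : 43593572/10⁷ ≤ …` — `m₁ = 1`: every brick below `θ = 1` (to be refined by certified periodic CLASS cells,
  `RayC1KernelPeriodicClass`, which override brick pieces where stronger — generator `gen_periodic.py --pw`).
-/

namespace Summit.KontsevichZagierPeriods.Zeta5Search.RayC1

open Summit.KontsevichZagierPeriods.Zeta5Search.RayKernel

/-- **The brick periodic table of the ray** (772 entries, sorted). -/
def c1PerBricks : List WinEntry := c1PerBrickA ++ c1PerBrickB

/-- It passes the brick checker. -/
theorem c1PerBricks_ok : c1PerBricks.all pBrickCond = true := by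
  rw [c1PerBricks, List.all_append, c1PerBrickA_ok, c1PerBrickB_ok]; rfl

/-- It is chained (cells sorted and separated). -/
theorem c1PerBricks_chain : chainOK c1PerBricks = true :=
  chainOK_append c1PerBrickA_chain c1PerBrickB_chain (by decide +kernel)

/-- **Closed-form rate at `m₁ = 16` ≥ `2855032/10⁷`** (exact value `A_rate16 + B_rate16`). -/
theorem c1PerBricks_rate16_ge : (2855032 / 10000000 : ℚ) ≤ (c1PerBricks.map (pterm 16)).sum := by
  rw [c1PerBricks, prate_append, c1PerBrickA_rate16, c1PerBrickB_rate16]; norm_num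

/-- **Closed-form rate at `m₁ = 4` ≥ `11391629/10⁷`.** -/
theorem c1PerBricks_rate4_ge : (11391629 / 10000000 : ℚ) ≤ (c1PerBricks.map (pterm 4)).sum := by
  rw [c1PerBricks, prate_append, c1PerBrickA_rate4, c1PerBrickB_rate4]; norm_num

/-- **Closed-form rate at `m₁ = 1` ≥ `43593572/10⁷`.** -/
theorem c1PerBricks_rate1_ge : (43593572 / 10000000 : ℚ) ≤ (c1PerBricks.map (pterm 1)).sum := by
  rw [c1PerBricks, prate_append, c1PerBrickA_rate1, c1PerBrickB_rate1]; norm_num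

/-- The brick checker is sound from `NT = 1` (re-export of `psound_brick` for round files). -/
theorem psound_bricks_one : PSound pBrickCond 1 := psound_brick le_rfl

end Summit.KontsevichZagierPeriods.Zeta5Search.RayC1
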